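import Summits.BirchSwinnertonDyer.BirchSwinnertonDyer.Theorems.ManinLocalTwoThreeStevensCurveDatum
import Summits.BirchSwinnertonDyer.BirchSwinnertonDyer.Theorems.ManinLocalTwoThreeKummerValuesHalfIndex
import Summits.BirchSwinnertonDyer.BirchSwinnertonDyer.Theorems.ManinLocalTwoThreeShimuraKernelCyclicOfThreeFacts
import Summits.BirchSwinnertonDyer.Rank1Residual.ManinAdditive.KummerDiamondReciprocity
import HarnessLib

/-!
# CES eliminated: the half-index Kummer values, E-es-187/188 and Stevens cyclicity (Derickx–Orlić) WITHOUT the printed fact CES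
(route `ManinLocalTwoThree`, crux C2 stmt-BirchSwinnertonDyer-22967; cell bsd-f2-manin, prover p3 gen 21; CES-discharge programme, stage 2; route-independent
module — no `Theses` import)

Every consumer of CES = `exists_optimal_gamma1ParametrizationData` (Conrad–Edixhoven–Stein 2003 §6.1 / Stevens 1989 §2) in the cell used only an
elliptic `W₁/ℚ` with an OPTIMAL `X₁(N)`-datum, `ℚ`-isogenous to `W₀`; the sibling `…StevensCurveDatum` PROVES that (CES♭,
`StevensCurve.exists_optimal_gamma1ParametrizationData_one`: `W₁ = ℂ/Λ₁(f)` over `ℚ`, `c₁ = 1`).  This file re-derives the consumers with the CES binder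
GONE (the proofs are those of p3 gen 20, `…KummerValuesHalfIndex` §3–§4 / `…ShimuraKernelCyclicOfThreeFacts` / `…ManinConstantOfStevensInclusion`
§3–§4, with `hCES W₀ D₀ hopt` replaced by the theorem; global minimality of `W₀` is dropped where it only served CES):

* §1 `halfIndex_kummerValues_of_Tes75` — KDR½: THEOREM K's Kummer values in the half-index world ⟸ T-es-75 ALONE;
* §2 `two_pow_five_dvd_and_hasFreyTwistShape_of_halfIndex_of_Tes75` (E-es-187 per datum ⟸ T-es-75), `not_halfIndex_of_modularity_Tes75`
  (E-es-188 per datum ⟸ modularity ∧ T-es-75), `not_periodLatticeGamma1_le_prime_mul_of_modularity_Tes75` (no prime `p` with `Λ₁ ⊆ pΛ₀`);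
* §3 `shimuraKernelCyclic_body_of_modularity_Tes75`, **`shimuraKernelCyclic_of_modularity_Tes75 : exists_isNewformOf → T-es-75 →
  ShimuraCyclic.ShimuraKernelCyclic`** (desc g26 row 2 = the cyclicity of `Σ(N) ∩ E₀` asked by Derickx–Orlić 2025, BY NAME ⟸ TWO printed facts),
  `gamma1PeriodsNotInsideTwice_of_modularity_Tes75` (row 1), `shimuraIndexNeFourAtFour_of_modularity_Tes75_viaCyclicity` (E-an-152b);
* (sibling `…StevensCurveRung`, inside the route cone: `2 ∣ c₀ ⟹ 2⁵ ∣ N`, Abbes–Ullmo / Česnavičius ⟸ {CDT, T-es-75}, and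
  `maninConstantOne_of_threePrintedFacts : exists_isNewformOf → CDT → T-es-75 → ManinConstantOne`.)

HONEST FRAMING: CONDITIONAL theorems — T-es-75 (Stevens 1982 Thm 1.3.1 (b)), CDT (Calegari–Dimitrov–Tang Thm 1) and modularity are statement-only
printed facts, undischarged; CES is no longer among them.  Manin's conjecture, C2, C3 and BSD are NOT proved by this file; the items stay OPEN.
[cite: Stevens1982, §1.3 Thm. 1.3.1 (b)] [cite: Stevens1989, §2] [cite: CalegariDimitrovTang2025, Thm. 1] [cite: ConradEdixhovenStein2003, §6.1]
[cite: Vatsal2005, Conj. 1.9] [cite: AbbesUllmo1996, Thm. A] [cite: Cesnavicius2018, Thm. 1.2]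
-/

set_option autoImplicit false
-- lint-debt: the directory name repeats the summit name (sibling precedent `ManinLocalTwoThreeKummerValuesHalfIndex.lean`)
set_option linter.dupNamespace false

noncomputable section

open scoped Classical MatrixGroups
open Complex CongruenceSubgroup WeierstrassCurve
open Literature.NumberTheory.EllipticCurves Literature.NumberTheory.EllipticCurves.ModularForms
open Literature.NumberTheory.EllipticCurves.Greenberg1999 Literature.NumberTheory.Automorphic
open Summit.BirchSwinnertonDyer.Rank1Residual.ManinAdditive
open Summit.BirchSwinnertonDyer.Rank1Residual.ManinAdditive.KummerDiamond

namespace Summit.BirchSwinnertonDyer.BirchSwinnertonDyer.Theorems.ManinLocalTwoThree.StevensCurve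

/-! ## §1 KDR½ ⟸ T-es-75 alone -/

/-- **KDR½ ⟸ T-es-75 (CES eliminated): the Kummer values `σ(S_y) − S_y = π₀(c₀{∞,γ∞}_f/2)` in the half-index world `Λ₁(f) ⊆ 2Λ₀(f)`, for
every lattice-optimal `X₀(N)`-datum of an elliptic `W₀/ℚ` (any `c₀`, no minimality).**  Proof: the Stevens curve `W₁ = ℂ/Λ₁(f)` over `ℚ` with its
optimal `X₁(N)`-datum `D₁` (`c₁ = 1`, `StevensCurve.exists_optimal_gamma1ParametrizationData_one`), THEOREM K♮ on it (`kummerDiamondReciprocity`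
⟸ T-es-75), and the `ℚ`-isogeny `W₁ → W₀` attached to `(c₀/2)·Λ₁(f) ⊆ c₀Λ₀(f) ⊆ Λ_{W₀}` (`exists_isogeny_baseChange_apply_eq_of_forall_mul_mem_lattice`),
which is `Aut(ℂ/ℚ)`-equivariant on complex points (`Isogeny.map_baseChange`).  CONDITIONAL on T-es-75 only.
[cite: Stevens1982, §1.3 Thm. 1.3.1 (b)] [cite: Stevens1989, §2] [cite: SilvermanAEC2009, Thm. VI.4.1] -/
theorem halfIndex_kummerValues_of_Tes75 (hSt : optimalGamma1Parametrization_cuspInv_galoisAction)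
    (W₀ : WeierstrassCurve ℚ) [W₀.IsElliptic] {N : ℕ} [NeZero N] (D₀ : ModularParametrizationData W₀ N)
    (hopt : ∀ z ∈ D₀.L.lattice, ∃ w ∈ periodLattice D₀.f, z = D₀.c * w)
    (hhalf : ∀ z ∈ periodLatticeGamma1 D₀.f, ∃ w ∈ periodLattice D₀.f, z = 2 * w)
    (σ : ℂ ≃ₐ[ℚ] ℂ) (d d' : ℤ) (hdd' : ((d * d' : ℤ) : ZMod N) = 1)
    (hσ : σ (Complex.exp (2 * Real.pi * Complex.I / N)) = Complex.exp (2 * Real.pi * Complex.I * d / N))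
    (Q y : ℕ) (hQy : Q * y = N) (hcop : Nat.Coprime Q y) (γ : Gamma0 N)
    (hγQ : (((γ : SL(2, ℤ)) 1 1 : ℤ) : ZMod Q) = (d' : ZMod Q)) (hγy : (((γ : SL(2, ℤ)) 1 1 : ℤ) : ZMod y) = 1) :
    Affine.Point.map (W' := W₀) (σ : ℂ →ₐ[ℚ] ℂ) (D₀.uniformize ((D₀.c : ℂ) * modularSymbol D₀.f (1 / (y : ℚ)) / 2)) =
      D₀.uniformize ((D₀.c : ℂ) * modularSymbol D₀.f (1 / (y : ℚ)) / 2) +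
        D₀.uniformize ((D₀.c : ℂ) * cuspSymbol D₀.f γ / 2) := by
  -- the Stevens curve over `ℚ` with its optimal `X₁(N)`-datum of Manin constant `1`, and THEOREM K♮ on it
  obtain ⟨W₁, _, D₁, hf, hc₁, hD₁, hL₁, -⟩ := exists_optimal_gamma1ParametrizationData_one D₀ hopt
  have hK := kummerDiamondReciprocity hSt W₁ D₁ hD₁ σ d d' hdd' hσ Q y hQy hcop γ hγQ hγy
  rw [hf, hc₁] at hK
  -- the `ℚ`-isogeny `z ↦ r z`, `r = c₀/2`
  have hc₀ : D₀.c ≠ 0 := D₀.maninConstant_ne_zero_holds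
  set r : ℚ := (D₀.c : ℚ) / 2 with hr
  have hr0 : r ≠ 0 := by rw [hr]; exact div_ne_zero (by exact_mod_cast hc₀) two_ne_zero
  have hrc : (r : ℂ) = (D₀.c : ℂ) / 2 := by rw [hr]; push_cast; ring
  have hle : ∀ z ∈ D₁.L.lattice, (r : ℂ) * z ∈ D₀.L.lattice := by
    intro z hz
    obtain ⟨v, hv, hzv⟩ := hhalf z ((hL₁ z).mp hz)
    have e : (r : ℂ) * z = (D₀.c : ℂ) * v := by rw [hzv, hrc]; ring
    rw [e]; exact D₀.smul_periodLattice_le v hv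
  haveI : Algebra.IsAlgebraic ℚ (AlgebraicClosure ℚ) := AlgebraicClosure.isAlgebraic ℚ
  haveI : IsAlgClosure ℚ (AlgebraicClosure ℚ) := AlgebraicClosure.instIsAlgClosure ℚ
  haveI : Normal ℚ (AlgebraicClosure ℚ) := IsAlgClosure.normal ℚ (AlgebraicClosure ℚ)
  letI : Algebra (AlgebraicClosure ℚ) ℂ := (IsAlgClosed.lift : AlgebraicClosure ℚ →ₐ[ℚ] ℂ).toRingHom.toAlgebra
  haveI : IsScalarTower ℚ (AlgebraicClosure ℚ) ℂ := IsScalarTower.of_algebraMap_eq' (Subsingleton.elim _ _)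
  obtain ⟨ψ, hψ, -, -⟩ := exists_isogeny_baseChange_apply_eq_of_forall_mul_mem_lattice
    D₁.isNeronLattice.1 D₁.isNeronLattice.2 D₀.isNeronLattice.1 D₀.isNeronLattice.2
    D₁.ker_uniformize D₁.uniformize_surjective D₁.uniformize_spec D₀.ker_uniformize D₀.uniformize_spec hr0 hle
  -- `σ` restricted to `ℚ̄ ⊂ ℂ`, and the equivariance of `ψ_ℂ`
  set τ₀ : AlgebraicClosure ℚ ≃ₐ[ℚ] AlgebraicClosure ℚ := σ.restrictNormal (AlgebraicClosure ℚ) with hτ₀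
  have hστ : ∀ c : AlgebraicClosure ℚ, (σ : ℂ →ₐ[ℚ] ℂ) (algebraMap (AlgebraicClosure ℚ) ℂ c) =
      algebraMap (AlgebraicClosure ℚ) ℂ (Field.absoluteGaloisGroup.toAlgEquiv ℚ ((Field.absoluteGaloisGroup.toAlgEquiv ℚ).symm τ₀) c) := by
    intro c
    rw [MulEquiv.apply_symm_apply, hτ₀]
    exact (AlgEquiv.restrictNormal_commutes σ (AlgebraicClosure ℚ) c).symm
  have hequiv : ∀ P : (W₁.baseChange ℂ).toAffine.Point,
      Affine.Point.map (W' := W₀) (σ : ℂ →ₐ[ℚ] ℂ) (ψ.baseChange (M := ℂ) P) =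
        ψ.baseChange (M := ℂ) (Affine.Point.map (W' := W₁) (σ : ℂ →ₐ[ℚ] ℂ) P) :=
    fun P ↦ ψ.map_baseChange (σ : ℂ →ₐ[ℚ] ℂ) ((Field.absoluteGaloisGroup.toAlgEquiv ℚ).symm τ₀) hστ P
  -- push THEOREM K♮ through `ψ_ℂ`
  have hK' := congrArg (ψ.baseChange (M := ℂ)) hK
  rw [← hequiv, map_add, hψ, hψ] at hK'
  have e1 : (r : ℂ) * ((((1 : ℤ) : ℤ) : ℂ) * modularSymbol D₀.f (1 / (y : ℚ))) = (D₀.c : ℂ) * modularSymbol D₀.f (1 / (y : ℚ)) / 2 := by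
    rw [hrc]; push_cast; ring
  have e2 : (r : ℂ) * ((((1 : ℤ) : ℤ) : ℂ) * cuspSymbol D₀.f γ) = (D₀.c : ℂ) * cuspSymbol D₀.f γ / 2 := by
    rw [hrc]; push_cast; ring
  rw [e1, e2] at hK'
  exact hK'

/-! ## §2 E-es-187 / E-es-188 per datum and the prime-by-prime exclusion, without CES -/

/-- **E-es-187 per datum ⟸ T-es-75**: in the half-index world a lattice-optimal datum has `2⁵ ∣ N` and the Frey-twist shape (§1 Kummer values into
p3 gen 20's `two_pow_five_dvd_and_hasFreyTwistShape_of_halfIndex_of_kummerValues`).  CONDITIONAL on T-es-75; nothing about BSD.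
[cite: Stevens1982, §1.3 Thm. 1.3.1 (b)] [cite: Stevens1989, §2] -/
theorem two_pow_five_dvd_and_hasFreyTwistShape_of_halfIndex_of_Tes75 (hSt : optimalGamma1Parametrization_cuspInv_galoisAction)
    (W₀ : WeierstrassCurve ℚ) [W₀.IsElliptic] {N : ℕ} [NeZero N] (D₀ : ModularParametrizationData W₀ N)
    (hopt : ∀ z ∈ D₀.L.lattice, ∃ w ∈ periodLattice D₀.f, z = D₀.c * w)
    (hhalf : ∀ z ∈ periodLatticeGamma1 D₀.f, ∃ w ∈ periodLattice D₀.f, z = 2 * w) :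
    2 ^ 5 ∣ N ∧ HasFreyTwistShape W₀ :=
  KummerValues.two_pow_five_dvd_and_hasFreyTwistShape_of_halfIndex_of_kummerValues W₀ D₀ hopt hhalf
    (halfIndex_kummerValues_of_Tes75 hSt W₀ D₀ hopt hhalf)

/-- **E-es-188 per datum ⟸ modularity ∧ T-es-75 (CES eliminated): `Λ₁(f) ⊄ 2Λ₀(f)` for every lattice-optimal `X₀(N)`-datum.**  CONDITIONAL on two
statement-only printed facts. [cite: Stevens1982, §1.3 Thm. 1.3.1 (b)] [cite: Stevens1989, §2] [cite: Vatsal2005, Thm. 1.10] -/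
theorem not_halfIndex_of_modularity_Tes75 (hnf : exists_isNewformOf) (hSt : optimalGamma1Parametrization_cuspInv_galoisAction)
    (W₀ : WeierstrassCurve ℚ) [W₀.IsElliptic] {N : ℕ} [NeZero N] (D₀ : ModularParametrizationData W₀ N)
    (hopt : ∀ z ∈ D₀.L.lattice, ∃ w ∈ periodLattice D₀.f, z = D₀.c * w) :
    ¬ (∀ z ∈ periodLatticeGamma1 D₀.f, ∃ w ∈ periodLattice D₀.f, z = 2 * w) := fun hhalf ↦
  KummerValues.not_halfIndex_of_modularity_of_kummerValues hnf W₀ D₀ hopt hhalf (halfIndex_kummerValues_of_Tes75 hSt W₀ D₀ hopt hhalf)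

/-- **No prime `p` with `Λ₁(f) ⊆ pΛ₀(f)` — the kernel of the Stevens isogeny is CYCLIC on the lattice-optimal member — modulo modularity ∧ T-es-75**
(`p = 2`: `not_halfIndex_of_modularity_Tes75`; `p ≥ 3`: fact-free, `KummerValues.not_periodLatticeGamma1_le_natCast_mul_periodLattice`).  CONDITIONAL.
[cite: Stevens1989, §2] [cite: Stevens1982, §1.3 Thm. 1.3.1 (b)] [cite: Vatsal2005, Thm. 1.10] -/
theorem not_periodLatticeGamma1_le_prime_mul_of_modularity_Tes75 (hnf : exists_isNewformOf)
    (hSt : optimalGamma1Parametrization_cuspInv_galoisAction)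
    (W₀ : WeierstrassCurve ℚ) [W₀.IsElliptic] {N : ℕ} [NeZero N] (D₀ : ModularParametrizationData W₀ N)
    (hopt : ∀ z ∈ D₀.L.lattice, ∃ w ∈ periodLattice D₀.f, z = D₀.c * w) {p : ℕ} (hp : p.Prime) :
    ¬ (∀ z ∈ periodLatticeGamma1 D₀.f, ∃ w ∈ periodLattice D₀.f, z = (p : ℂ) * w) := by
  rcases hp.eq_two_or_odd' with rfl | hodd
  · exact_mod_cast not_halfIndex_of_modularity_Tes75 hnf hSt W₀ D₀ hopt
  · obtain ⟨k, hk⟩ := hodd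
    exact KummerValues.not_periodLatticeGamma1_le_natCast_mul_periodLattice D₀ hopt (by have := hp.two_le; omega)

/-! ## §3 Stevens cyclicity (desc g26 rows 1–2, the Derickx–Orlić question) modulo TWO printed facts -/

/-- **The Shimura kernel `Λ₀(f)/Λ₁(f)` of a lattice-optimal datum is CYCLIC, modulo {modularity, T-es-75}** (§2 + E-es-190
`ShimuraKernelLattice.cyclic_of_forall_prime_not_le_datum`).  Verbatim the body of desc's `ShimuraCyclic.ShimuraKernelCyclic` at `D₀`.  CONDITIONAL.
[cite: Vatsal2005, Rem. 1.8, Conj. 1.9] [cite: Stevens1982, §1.3 Thm. 1.3.1 (b)] [cite: Stevens1989, §2] -/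
theorem shimuraKernelCyclic_body_of_modularity_Tes75 (hnf : exists_isNewformOf) (hSt : optimalGamma1Parametrization_cuspInv_galoisAction)
    (W₀ : WeierstrassCurve ℚ) [W₀.IsElliptic] {N : ℕ} [NeZero N] (D₀ : ModularParametrizationData W₀ N)
    (hopt : ∀ z ∈ D₀.L.lattice, ∃ w ∈ periodLattice D₀.f, z = D₀.c * w) :
    ∃ z₀ ∈ periodLattice D₀.f, ∀ z ∈ periodLattice D₀.f,
      ∃ (k : ℤ) (w : ℂ), w ∈ periodLatticeGamma1 D₀.f ∧ z = (k : ℂ) * z₀ + w :=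
  ShimuraKernelLattice.cyclic_of_forall_prime_not_le_datum D₀ fun _ hp ↦
    not_periodLatticeGamma1_le_prime_mul_of_modularity_Tes75 hnf hSt W₀ D₀ hopt hp

/-- **desc g26 row 2 `ShimuraCyclic.ShimuraKernelCyclic` — «`Σ(N) ∩ E₀`, i.e. `Λ₀(f)/Λ₁(f)`, is CYCLIC for every modular parametrisation
datum» (the question asked in print by Derickx–Orlić 2025, MEMO-es §62) — BY NAME modulo exactly TWO statement-only printed facts {modularity, T-es-75}**
(CES eliminated by the Stevens-curve theorem; EXO from modularity, es g40).  CONDITIONAL; Manin's conjecture and BSD are NOT proved.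
[cite: Vatsal2005, Conj. 1.9] [cite: Stevens1989, §2] [cite: Stevens1982, §1.3 Thm. 1.3.1 (b)] -/
theorem shimuraKernelCyclic_of_modularity_Tes75 (hnf : exists_isNewformOf) (hSt : optimalGamma1Parametrization_cuspInv_galoisAction) :
    ShimuraCyclic.ShimuraKernelCyclic := by
  intro W _ N _ D
  obtain ⟨W₀, _, _, D₀, hf, hopt⟩ := ExistsMinimalOptimalDatum.existsMinimalOptimalDatum_forall_of_modularity hnf W D
  rw [← hf]
  exact shimuraKernelCyclic_body_of_modularity_Tes75 hnf hSt W₀ D₀ hopt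

/-- **desc g26 row 1 `Gamma1PeriodsNotInsideTwiceGamma0Periods` BY NAME ⟸ {modularity, T-es-75}.** CONDITIONAL. [cite: Stevens1989, §2] -/
theorem gamma1PeriodsNotInsideTwice_of_modularity_Tes75 (hnf : exists_isNewformOf) (hSt : optimalGamma1Parametrization_cuspInv_galoisAction) :
    ShimuraCyclic.Gamma1PeriodsNotInsideTwiceGamma0Periods :=
  ShimuraCyclic.notInsideTwice_of_shimuraKernelCyclic (shimuraKernelCyclic_of_modularity_Tes75 hnf hSt)

/-- **E-an-152b `ShimuraIndexNeFourAtFour` BY NAME via the cyclicity road ⟸ {modularity, T-es-75}.** CONDITIONAL. [cite: Stevens1989, §2] -/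
theorem shimuraIndexNeFourAtFour_of_modularity_Tes75_viaCyclicity (hnf : exists_isNewformOf)
    (hSt : optimalGamma1Parametrization_cuspInv_galoisAction) : ShimuraKernel.ShimuraIndexNeFourAtFour :=
  ShimuraCyclic.shimuraIndexNeFourAtFour_of_shimuraKernelCyclic (shimuraKernelCyclic_of_modularity_Tes75 hnf hSt)

end Summit.BirchSwinnertonDyer.BirchSwinnertonDyer.Theorems.ManinLocalTwoThree.StevensCurve

end
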